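import Literature.Topology.FourManifolds.TrisectionsTubeModel
import HarnessLib

/-!
# The chart-zone core of the sector function: `A(|x|²) · w(c ĝ(x))` has only the central critical point

Topic `Literature/Topology/FourManifolds`; model-space calculus (step E2a) for the fact seat
`provefact-Literature.Topology.FourManifolds.exists_isBalancedGKTrisection` (Gay–Kirby 2016,
Thm. 4 via §4, Lemma 14).  Everything in this file is **proved**; the definitions are explicit
functions on `ℝ²`.

In Milnor's coordinates `(x, y) ∈ ℝ² × ℝ²` of a `2`-handle, the Morse function of the second
sector of the Morse-theoretic trisection is, on the core zone `{|x|² < a_R}` and on the core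
plane `y = 0`, of the form `Φ₀(x) = A(|x|²) · w(c ĝ(x))` with `ĝ(x) = 1 - ε x₀² ρ(|x|²)` the
smoothed angular part of the tube function (`ρ(a) = 1/a` away from the centre), `w` the
positive non-increasing weight and `A(a) = U(η - a)(β₀ + a)R(a)` the product of the two face
functions and the radial correction.  Under the single design inequality
`A'(a) w(t) + A(a) |w'(t)| c ε ρ(a) < 0` (with `ρ ≥ 0`, `ρ' ≤ 0`, `w > 0`, `w' ≤ 0`, `A > 0`)
this file proves:

* `ChartZone.eq_zero_of_fderiv_core_eq_zero` — the only critical point of `Φ₀` in the zone is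
  the centre `x = 0` (the critical point `c_j` of `f`);
* `ChartZone.fderiv_fderiv_core_zero_apply` — its Hessian there is
  `2(A'(0)w(c) - A(0)|w'(c)| … ) v₀w₀ + 2A'(0)w(c) v₁w₁`… precisely
  `2(A'(0) w(c) + A(0) w'(c) c (-ε ρ(0))) v₀ w₀ + 2 A'(0) w(c) v₁ w₁`, negative definite, so that
  `1 - C Φ₀` has a nondegenerate minimum at the centre (`ChartZone.posDef_neg_hessian_core`).

With `TrisectionsRadialThickening.lean` (critical points and index of `Φ(x, |y|²)`) this is the
chart-zone half of the statement that the second sector's Morse function has, inside each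
`2`-handle, exactly one critical point, of index `0` — the Morse-theoretic form of Gay–Kirby's
"the `2`-handles cancel `g - k` of the `S¹ × B³`'s" (proof of Lemma 14).

## References

* D. Gay, R. Kirby, *Trisecting 4-manifolds*, Geom. Topol. 20 (2016), §4, Lemma 14. [GayKirby2016]
* J. Milnor, *Morse theory* (1963), §2. [Milnor1963]
* J. Milnor, *Lectures on the h-cobordism theorem* (1965), Def. 3.1. [MilnorHCobordism1965]
-/

open scoped Topology Manifold ContDiff
open Set Function Filter

noncomputable section

namespace Literature.Topology.FourManifolds

/-- Local notation: `𝔼 n` is the model Euclidean space `EuclideanSpace ℝ (Fin n)`. -/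
local notation "𝔼 " n:arg => EuclideanSpace ℝ (Fin n)

namespace ChartZone

open TubeModel

variable {A w ρ : ℝ → ℝ} {c ε : ℝ}

/-! ### The smoothed angular part `ĝ` and the core function -/

/-- **The smoothed angular part of the tube function**: `ĝ(x) = 1 - ε x₀² ρ(|x|²)`; for
`ρ(a) = 1/a` this is `g(x) = 1 - ε x₀²/|x|² = 1 - ε cos²θ`. [cite: GayKirby2016, §4, Lemma 14] -/
def gmod (ε : ℝ) (ρ : ℝ → ℝ) (x : 𝔼 2) : ℝ := 1 - ε * (x 0 ^ 2 * ρ (nsq x))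

/-- Unfolding of `gmod`. [folklore] -/
theorem gmod_apply (ε : ℝ) (ρ : ℝ → ℝ) (x : 𝔼 2) : gmod ε ρ x = 1 - ε * (x 0 ^ 2 * ρ (nsq x)) := rfl

/-- **The chart-zone core** `Φ₀(x) = A(|x|²) · w(c ĝ(x))`. [cite: GayKirby2016, §4, Lemma 14] -/
def core (A w ρ : ℝ → ℝ) (c ε : ℝ) (x : 𝔼 2) : ℝ := A (nsq x) * w (c * gmod ε ρ x)

/-- Unfolding of `core`. [folklore] -/
theorem core_apply (A w ρ : ℝ → ℝ) (c ε : ℝ) (x : 𝔼 2) :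
    core A w ρ c ε x = A (nsq x) * w (c * gmod ε ρ x) := rfl

/-! ### First derivatives -/

/-- `D(ρ ∘ |·|²)_x = ρ'(|x|²) (2x₀ dx₀ + 2x₁ dx₁)`. [folklore] -/
theorem hasFDerivAt_comp_nsq {φ : ℝ → ℝ} {x : 𝔼 2} (hφ : DifferentiableAt ℝ φ (nsq x)) :
    HasFDerivAt (fun y => φ (nsq y))
      (deriv φ (nsq x) • ((2 * x 0) • (d0 : 𝔼 2 →L[ℝ] ℝ) + (2 * x 1) • (d1 : 𝔼 2 →L[ℝ] ℝ))) x := by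
  have h := hφ.hasDerivAt.comp_hasFDerivAt x (hasFDerivAt_nsq x)
  exact h

/-- **The derivative of `ĝ`**:
`Dĝ_x = -ε [(2x₀ ρ + 2x₀³ ρ') dx₀ … ]`, precisely
`Dĝ_x = -ε (2 x₀ ρ(a)) dx₀ - ε x₀² ρ'(a) (2x₀ dx₀ + 2x₁ dx₁)`, `a = |x|²`. [folklore] -/
theorem hasFDerivAt_gmod {x : 𝔼 2} (hρ : DifferentiableAt ℝ ρ (nsq x)) :
    HasFDerivAt (gmod ε ρ)
      (-(ε • ((ρ (nsq x) * (2 * x 0)) • (d0 : 𝔼 2 →L[ℝ] ℝ) +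
        (x 0 ^ 2 * deriv ρ (nsq x)) • ((2 * x 0) • (d0 : 𝔼 2 →L[ℝ] ℝ) + (2 * x 1) • (d1 : 𝔼 2 →L[ℝ] ℝ))))) x := by
  have h1 : HasFDerivAt (fun y : 𝔼 2 => (d0 : 𝔼 2 →L[ℝ] ℝ) y ^ 2) ((2 * x 0) • (d0 : 𝔼 2 →L[ℝ] ℝ)) x := by
    have := (d0.hasFDerivAt (x := x)).pow 2
    refine this.congr_fderiv ?_
    ext v; simp
  have h2 := hasFDerivAt_comp_nsq (x := x) hρ
  have h3 := h1.mul h2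
  have h4 := (h3.const_mul ε).neg.const_add 1
  have hfun : gmod ε ρ = fun y => 1 + -(ε * ((d0 : 𝔼 2 →L[ℝ] ℝ) y ^ 2 * ρ (nsq y))) := by
    funext y; simp [gmod_apply, sub_eq_add_neg]
  rw [hfun]
  refine h4.congr_fderiv ?_
  ext v
  simp only [smul_add, neg_apply, smul_apply,
    add_apply, d0_apply, d1_apply, smul_eq_mul, neg_inj]
  ring

/-- `ĝ` is differentiable where `ρ` is. [folklore] -/
theorem differentiableAt_gmod {x : 𝔼 2} (hρ : DifferentiableAt ℝ ρ (nsq x)) :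
    DifferentiableAt ℝ (gmod ε ρ) x :=
  (hasFDerivAt_gmod hρ).differentiableAt

/-- **The derivative of the core**: with `a = |x|²`, `t = c ĝ(x)`,
`DΦ₀ = 2x₀ [A'(a) w(t) - A(a) w'(t) c ε (ρ(a) + x₀² ρ'(a))] dx₀
      + 2x₁ [A'(a) w(t) - A(a) w'(t) c ε x₀² ρ'(a)] dx₁`. [folklore] -/
theorem hasFDerivAt_core {x : 𝔼 2} (hA : DifferentiableAt ℝ A (nsq x))
    (hw : DifferentiableAt ℝ w (c * gmod ε ρ x)) (hρ : DifferentiableAt ℝ ρ (nsq x)) :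
    HasFDerivAt (core A w ρ c ε)
      ((2 * x 0 * (deriv A (nsq x) * w (c * gmod ε ρ x) -
          A (nsq x) * deriv w (c * gmod ε ρ x) * c * ε * (ρ (nsq x) + x 0 ^ 2 * deriv ρ (nsq x)))) •
          (d0 : 𝔼 2 →L[ℝ] ℝ) +
        (2 * x 1 * (deriv A (nsq x) * w (c * gmod ε ρ x) -
          A (nsq x) * deriv w (c * gmod ε ρ x) * c * ε * (x 0 ^ 2 * deriv ρ (nsq x)))) •
          (d1 : 𝔼 2 →L[ℝ] ℝ)) x := by
  have h1 := hasFDerivAt_comp_nsq (x := x) hA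
  have h2 : HasFDerivAt (fun y => w (c * gmod ε ρ y))
      (deriv w (c * gmod ε ρ x) • (c • -(ε • ((ρ (nsq x) * (2 * x 0)) • (d0 : 𝔼 2 →L[ℝ] ℝ) +
        (x 0 ^ 2 * deriv ρ (nsq x)) • ((2 * x 0) • (d0 : 𝔼 2 →L[ℝ] ℝ) + (2 * x 1) • (d1 : 𝔼 2 →L[ℝ] ℝ)))))) x :=
    hw.hasDerivAt.comp_hasFDerivAt x ((hasFDerivAt_gmod hρ).const_smul c)
  have h3 := h1.mul h2
  refine h3.congr_fderiv ?_
  ext v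
  simp only [add_apply, smul_apply, smul_add, smul_neg,
    neg_apply, d0_apply, d1_apply, smul_eq_mul]
  ring

/-- The core is differentiable where `A`, `w`, `ρ` are. [folklore] -/
theorem differentiableAt_core {x : 𝔼 2} (hA : DifferentiableAt ℝ A (nsq x))
    (hw : DifferentiableAt ℝ w (c * gmod ε ρ x)) (hρ : DifferentiableAt ℝ ρ (nsq x)) :
    DifferentiableAt ℝ (core A w ρ c ε) x :=
  (hasFDerivAt_core hA hw hρ).differentiableAt

/-! ### The only critical point in the zone is the centre -/

/-- **The design inequality** of the chart zone at radius² `a` and weight argument `t`: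
`A'(a) w(t) + A(a) |w'(t)| c ε ρ(a) < 0` (for non-increasing `w`: `|w'| = -w'`) — a hypothesis
predicate on the profile functions, not a claim. [cite: GayKirby2016, §4, Lemma 14] -/
def DesignIneq (A w ρ : ℝ → ℝ) (c ε a t : ℝ) : Prop :=
  deriv A a * w t - A a * deriv w t * c * ε * ρ a < 0

/-- The basis vector `(1, 0)` of `ℝ²`. [folklore] -/
def bx : 𝔼 2 := WithLp.toLp 2 ![1, 0]

/-- The basis vector `(0, 1)` of `ℝ²`. [folklore] -/
def by' : 𝔼 2 := WithLp.toLp 2 ![0, 1]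

/-- `(1, 0)₀ = 1`. [folklore] -/
@[simp] theorem bx_apply_zero : bx 0 = 1 := rfl
/-- `(1, 0)₁ = 0`. [folklore] -/
@[simp] theorem bx_apply_one : bx 1 = 0 := rfl
/-- `(0, 1)₀ = 0`. [folklore] -/
@[simp] theorem by'_apply_zero : by' 0 = 0 := rfl
/-- `(0, 1)₁ = 1`. [folklore] -/
@[simp] theorem by'_apply_one : by' 1 = 1 := rfl

/-- **The only critical point of the core in the zone is the centre.**  If at `x`:
`A > 0`, `ρ ≥ 0`, `ρ' ≤ 0`, `w' ≤ 0` (at `t = c ĝ(x)`), `c ε ≥ 0`, and the design inequality holds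
at `(|x|², c ĝ(x))`, then `DΦ₀(x) = 0` forces `x = 0`: the `dx₀`- and `dx₁`-components of `DΦ₀`
are `2x₀ K₀`, `2x₁ K₁` with `K₀, K₁ < 0`. [cite: GayKirby2016, §4, Lemma 14] -/
theorem eq_zero_of_fderiv_core_eq_zero {x : 𝔼 2}
    (hA : DifferentiableAt ℝ A (nsq x)) (hw : DifferentiableAt ℝ w (c * gmod ε ρ x))
    (hρ : DifferentiableAt ℝ ρ (nsq x))
    (hApos : 0 < A (nsq x)) (hρ0 : 0 ≤ ρ (nsq x)) (hρ' : deriv ρ (nsq x) ≤ 0)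
    (hw' : deriv w (c * gmod ε ρ x) ≤ 0) (hcε : 0 ≤ c * ε)
    (hD : DesignIneq A w ρ c ε (nsq x) (c * gmod ε ρ x))
    (h0 : fderiv ℝ (core A w ρ c ε) x = 0) : x = 0 := by
  set a := nsq x with ha
  set t := c * gmod ε ρ x with ht
  have hder := (hasFDerivAt_core (c := c) (ε := ε) hA hw hρ).fderiv
  rw [h0] at hder
  set K₀ := deriv A a * w t - A a * deriv w t * c * ε * (ρ a + x 0 ^ 2 * deriv ρ a) with hK₀
  set K₁ := deriv A a * w t - A a * deriv w t * c * ε * (x 0 ^ 2 * deriv ρ a) with hK₁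
  have hDes : deriv A a * w t - A a * deriv w t * c * ε * ρ a < 0 := hD
  -- signs
  have hN : 0 ≤ -(A a * deriv w t) := by nlinarith
  have hP : 0 ≤ -(A a * deriv w t) * (c * ε) := mul_nonneg hN hcε
  have hq : x 0 ^ 2 * deriv ρ a ≤ 0 := mul_nonpos_of_nonneg_of_nonpos (sq_nonneg _) hρ'
  have hK₁neg : K₁ < 0 := by
    have h1 : K₁ = deriv A a * w t + -(A a * deriv w t) * (c * ε) * (x 0 ^ 2 * deriv ρ a) := by
      rw [hK₁]; ring
    have h2 : -(A a * deriv w t) * (c * ε) * (x 0 ^ 2 * deriv ρ a) ≤ 0 := mul_nonpos_of_nonneg_of_nonpos hP hq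
    have h3 : deriv A a * w t + -(A a * deriv w t) * (c * ε) * ρ a < 0 := by linarith [hDes]
    have h4 : 0 ≤ -(A a * deriv w t) * (c * ε) * ρ a := mul_nonneg hP hρ0
    linarith
  have hK₀neg : K₀ < 0 := by
    have h1 : K₀ = (deriv A a * w t + -(A a * deriv w t) * (c * ε) * ρ a) +
        -(A a * deriv w t) * (c * ε) * (x 0 ^ 2 * deriv ρ a) := by
      rw [hK₀]; ring
    have h2 : -(A a * deriv w t) * (c * ε) * (x 0 ^ 2 * deriv ρ a) ≤ 0 := mul_nonpos_of_nonneg_of_nonpos hP hq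
    have h3 : deriv A a * w t + -(A a * deriv w t) * (c * ε) * ρ a < 0 := by linarith [hDes]
    linarith
  -- evaluate the vanishing derivative on the basis
  have e0 := congrArg (fun L : 𝔼 2 →L[ℝ] ℝ => L bx) hder
  have e1 := congrArg (fun L : 𝔼 2 →L[ℝ] ℝ => L by') hder
  simp only [zero_apply, add_apply,
    smul_apply, d0_apply, d1_apply, bx_apply_zero, bx_apply_one,
    by'_apply_zero, by'_apply_one, smul_eq_mul, mul_one, mul_zero, add_zero, zero_add] at e0 e1
  have hx0 : x 0 = 0 := by
    have : 2 * x 0 * K₀ = 0 := e0.symm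
    rcases mul_eq_zero.1 this with h | h
    · linarith [mul_eq_zero.1 h]
    · exact absurd h hK₀neg.ne
  have hx1 : x 1 = 0 := by
    have : 2 * x 1 * K₁ = 0 := e1.symm
    rcases mul_eq_zero.1 this with h | h
    · linarith [mul_eq_zero.1 h]
    · exact absurd h hK₁neg.ne
  ext i
  fin_cases i
  · simpa using hx0
  · simpa using hx1

/-! ### The Hessian at the centre -/

/-- The `dx₀`-bracket `K₀(x) = A'(a) w(t) - A(a) w'(t) c ε (ρ(a) + x₀² ρ'(a))`. [folklore] -/
def K₀f (A w ρ : ℝ → ℝ) (c ε : ℝ) (x : 𝔼 2) : ℝ :=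
  deriv A (nsq x) * w (c * gmod ε ρ x) -
    A (nsq x) * deriv w (c * gmod ε ρ x) * c * ε * (ρ (nsq x) + x 0 ^ 2 * deriv ρ (nsq x))

/-- The `dx₁`-bracket `K₁(x) = A'(a) w(t) - A(a) w'(t) c ε x₀² ρ'(a)`. [folklore] -/
def K₁f (A w ρ : ℝ → ℝ) (c ε : ℝ) (x : 𝔼 2) : ℝ :=
  deriv A (nsq x) * w (c * gmod ε ρ x) -
    A (nsq x) * deriv w (c * gmod ε ρ x) * c * ε * (x 0 ^ 2 * deriv ρ (nsq x))

/-- `|0|² = 0`. [folklore] -/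
@[simp] theorem nsq_zero : nsq (0 : 𝔼 2) = 0 := by simp [nsq_apply]

/-- `ĝ(0) = 1`. [folklore] -/
@[simp] theorem gmod_zero : gmod ε ρ 0 = 1 := by simp [gmod_apply]

/-- `K₀(0) = A'(0) w(c) - A(0) w'(c) c ε ρ(0)`. [folklore] -/
theorem K₀f_zero : K₀f A w ρ c ε 0 = deriv A 0 * w c - A 0 * deriv w c * c * ε * ρ 0 := by
  simp [K₀f]

/-- `K₁(0) = A'(0) w(c)`. [folklore] -/
theorem K₁f_zero : K₁f A w ρ c ε 0 = deriv A 0 * w c := by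
  simp [K₁f]

/-- `DΦ₀ = 2x₀ K₀ dx₀ + 2x₁ K₁ dx₁` as a function (everywhere differentiable data). [folklore] -/
theorem fderiv_core_eq (hA : Differentiable ℝ A) (hw : Differentiable ℝ w) (hρ : Differentiable ℝ ρ)
    (x : 𝔼 2) :
    fderiv ℝ (core A w ρ c ε) x =
      (2 * x 0 * K₀f A w ρ c ε x) • (d0 : 𝔼 2 →L[ℝ] ℝ) + (2 * x 1 * K₁f A w ρ c ε x) • (d1 : 𝔼 2 →L[ℝ] ℝ) :=
  (hasFDerivAt_core (hA _) (hw _) (hρ _)).fderiv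

/-- A `C²` function of one variable has a differentiable derivative. [folklore] -/
theorem differentiable_deriv_of_contDiff_two {φ : ℝ → ℝ} (hφ : ContDiff ℝ 2 φ) :
    Differentiable ℝ (deriv φ) :=
  hφ.differentiable_deriv_two

/-- The brackets are differentiable for `C²` data. [folklore] -/
theorem differentiable_K₀f (hA : ContDiff ℝ 2 A) (hw : ContDiff ℝ 2 w) (hρ : ContDiff ℝ 2 ρ) :
    Differentiable ℝ (K₀f A w ρ c ε) := by
  have hAd : Differentiable ℝ A := hA.differentiable (by norm_num)
  have hwd : Differentiable ℝ w := hw.differentiable (by norm_num)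
  have hρd : Differentiable ℝ ρ := hρ.differentiable (by norm_num)
  have hA' := differentiable_deriv_of_contDiff_two hA
  have hw' := differentiable_deriv_of_contDiff_two hw
  have hρ' := differentiable_deriv_of_contDiff_two hρ
  have hn : Differentiable ℝ (nsq : 𝔼 2 → ℝ) := (contDiff_nsq (m := 1)).differentiable one_ne_zero
  have hg : Differentiable ℝ (gmod ε ρ) := fun x => differentiableAt_gmod (hρd _)
  have ht : Differentiable ℝ fun x : 𝔼 2 => c * gmod ε ρ x := hg.const_mul c
  have h0 : Differentiable ℝ fun x : 𝔼 2 => x 0 := (d0 : 𝔼 2 →L[ℝ] ℝ).differentiable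
  unfold K₀f
  exact ((hA'.comp hn).mul (hwd.comp ht)).sub
    (((((hAd.comp hn).mul (hw'.comp ht)).mul (differentiable_const c)).mul (differentiable_const ε)).mul
      ((hρd.comp hn).add ((h0.pow 2).mul (hρ'.comp hn))))

/-- The brackets are differentiable for `C²` data. [folklore] -/
theorem differentiable_K₁f (hA : ContDiff ℝ 2 A) (hw : ContDiff ℝ 2 w) (hρ : ContDiff ℝ 2 ρ) :
    Differentiable ℝ (K₁f A w ρ c ε) := by
  have hAd : Differentiable ℝ A := hA.differentiable (by norm_num)
  have hwd : Differentiable ℝ w := hw.differentiable (by norm_num)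
  have hρd : Differentiable ℝ ρ := hρ.differentiable (by norm_num)
  have hA' := differentiable_deriv_of_contDiff_two hA
  have hw' := differentiable_deriv_of_contDiff_two hw
  have hρ' := differentiable_deriv_of_contDiff_two hρ
  have hn : Differentiable ℝ (nsq : 𝔼 2 → ℝ) := (contDiff_nsq (m := 1)).differentiable one_ne_zero
  have hg : Differentiable ℝ (gmod ε ρ) := fun x => differentiableAt_gmod (hρd _)
  have ht : Differentiable ℝ fun x : 𝔼 2 => c * gmod ε ρ x := hg.const_mul c
  have h0 : Differentiable ℝ fun x : 𝔼 2 => x 0 := (d0 : 𝔼 2 →L[ℝ] ℝ).differentiable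
  unfold K₁f
  exact ((hA'.comp hn).mul (hwd.comp ht)).sub
    (((((hAd.comp hn).mul (hw'.comp ht)).mul (differentiable_const c)).mul (differentiable_const ε)).mul
      ((h0.pow 2).mul (hρ'.comp hn)))

/-- **The second derivative of the core at the centre**, as the derivative of `DΦ₀`:
`D(DΦ₀)_0 = 2K₀(0) dx₀ ⊗ dx₀ + 2K₁(0) dx₁ ⊗ dx₁` (at `0` the factors `2x₀`, `2x₁` kill the
derivatives of the brackets). [cite: Milnor1963, §2] -/
theorem hasFDerivAt_fderiv_core_zero (hA : ContDiff ℝ 2 A) (hw : ContDiff ℝ 2 w) (hρ : ContDiff ℝ 2 ρ) :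
    HasFDerivAt (fderiv ℝ (core A w ρ c ε))
      (((2 * K₀f A w ρ c ε 0) • (d0 : 𝔼 2 →L[ℝ] ℝ)).smulRight (d0 : 𝔼 2 →L[ℝ] ℝ) +
        ((2 * K₁f A w ρ c ε 0) • (d1 : 𝔼 2 →L[ℝ] ℝ)).smulRight (d1 : 𝔼 2 →L[ℝ] ℝ)) 0 := by
  have hAd : Differentiable ℝ A := hA.differentiable (by norm_num)
  have hwd : Differentiable ℝ w := hw.differentiable (by norm_num)
  have hρd : Differentiable ℝ ρ := hρ.differentiable (by norm_num)
  have hfun : fderiv ℝ (core A w ρ c ε) = fun x =>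
      (2 * x 0 * K₀f A w ρ c ε x) • (d0 : 𝔼 2 →L[ℝ] ℝ) + (2 * x 1 * K₁f A w ρ c ε x) • (d1 : 𝔼 2 →L[ℝ] ℝ) :=
    funext (fderiv_core_eq hAd hwd hρd)
  rw [hfun]
  have hK₀ := (differentiable_K₀f (c := c) (ε := ε) hA hw hρ 0).hasFDerivAt
  have hK₁ := (differentiable_K₁f (c := c) (ε := ε) hA hw hρ 0).hasFDerivAt
  -- `x ↦ 2 x₀ K₀(x)` at `0`
  have hα : HasFDerivAt (fun x : 𝔼 2 => 2 * x 0 * K₀f A w ρ c ε x) ((2 * K₀f A w ρ c ε 0) • (d0 : 𝔼 2 →L[ℝ] ℝ)) 0 := by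
    have h2 : HasFDerivAt (fun x : 𝔼 2 => 2 * x 0) ((2 : ℝ) • (d0 : 𝔼 2 →L[ℝ] ℝ)) 0 := by
      simpa using ((d0 : 𝔼 2 →L[ℝ] ℝ).hasFDerivAt (x := 0)).const_mul (2 : ℝ)
    have h := h2.mul hK₀
    refine h.congr_fderiv ?_
    ext v
    simp
    ring
  have hβ : HasFDerivAt (fun x : 𝔼 2 => 2 * x 1 * K₁f A w ρ c ε x) ((2 * K₁f A w ρ c ε 0) • (d1 : 𝔼 2 →L[ℝ] ℝ)) 0 := by
    have h2 : HasFDerivAt (fun x : 𝔼 2 => 2 * x 1) ((2 : ℝ) • (d1 : 𝔼 2 →L[ℝ] ℝ)) 0 := by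
      simpa using ((d1 : 𝔼 2 →L[ℝ] ℝ).hasFDerivAt (x := 0)).const_mul (2 : ℝ)
    have h := h2.mul hK₁
    refine h.congr_fderiv ?_
    ext v
    simp
    ring
  exact (hα.smul_const (d0 : 𝔼 2 →L[ℝ] ℝ)).add (hβ.smul_const (d1 : 𝔼 2 →L[ℝ] ℝ))

/-- **The Hessian of the core at the centre**:
`D²Φ₀(0)(v, w) = 2K₀(0) v₀w₀ + 2K₁(0) v₁w₁` with `K₀(0) = A'(0)w(c) - A(0)w'(c)cερ(0)`,
`K₁(0) = A'(0)w(c)`. [cite: Milnor1963, §2] [cite: GayKirby2016, §4, Lemma 14] -/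
theorem fderiv_fderiv_core_zero_apply (hA : ContDiff ℝ 2 A) (hw : ContDiff ℝ 2 w) (hρ : ContDiff ℝ 2 ρ)
    (v u : 𝔼 2) :
    fderiv ℝ (fderiv ℝ (core A w ρ c ε)) 0 v u =
      2 * (deriv A 0 * w c - A 0 * deriv w c * c * ε * ρ 0) * (v 0 * u 0) +
        2 * (deriv A 0 * w c) * (v 1 * u 1) := by
  rw [(hasFDerivAt_fderiv_core_zero (c := c) (ε := ε) hA hw hρ).fderiv, K₀f_zero, K₁f_zero]
  simp only [add_apply, ContinuousLinearMap.smulRight_apply, smul_apply, d0_apply, d1_apply, smul_eq_mul]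
  ring

/-- `A'(0) w(c) < 0` from the design inequality at the centre (`A(0) > 0`, `w'(c) ≤ 0`, `cε ≥ 0`,
`ρ(0) ≥ 0`). [folklore] -/
theorem deriv_mul_w_neg_of_designIneq (hApos : 0 < A 0) (hρ0 : 0 ≤ ρ 0) (hw' : deriv w c ≤ 0)
    (hcε : 0 ≤ c * ε) (hD : DesignIneq A w ρ c ε 0 c) : deriv A 0 * w c < 0 := by
  have hDes : deriv A 0 * w c - A 0 * deriv w c * c * ε * ρ 0 < 0 := hD
  have hN : 0 ≤ -(A 0 * deriv w c) := by nlinarith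
  have h4 : 0 ≤ -(A 0 * deriv w c) * (c * ε) * ρ 0 := mul_nonneg (mul_nonneg hN hcε) hρ0
  nlinarith

/-- **The Hessian of the core at the centre is negative definite** under the design inequality
at `(0, c)` (and `A(0) > 0`, `ρ(0) ≥ 0`, `w'(c) ≤ 0`, `cε ≥ 0`): the centre `c_j` is a
nondegenerate maximum of `Φ₀`, i.e. a nondegenerate *minimum* of the sector function
`1 - C Φ₀` on the core plane. [cite: GayKirby2016, §4, Lemma 14] [cite: Milnor1963, §2] -/
theorem fderiv_fderiv_core_zero_apply_self_neg (hA : ContDiff ℝ 2 A) (hw : ContDiff ℝ 2 w)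
    (hρ : ContDiff ℝ 2 ρ) (hApos : 0 < A 0) (hρ0 : 0 ≤ ρ 0) (hw' : deriv w c ≤ 0) (hcε : 0 ≤ c * ε)
    (hD : DesignIneq A w ρ c ε 0 c) {v : 𝔼 2} (hv : v ≠ 0) :
    fderiv ℝ (fderiv ℝ (core A w ρ c ε)) 0 v v < 0 := by
  rw [fderiv_fderiv_core_zero_apply hA hw hρ]
  have hK₀ : deriv A 0 * w c - A 0 * deriv w c * c * ε * ρ 0 < 0 := hD
  have hK₁ : deriv A 0 * w c < 0 := deriv_mul_w_neg_of_designIneq hApos hρ0 hw' hcε hD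
  have hne : v 0 ≠ 0 ∨ v 1 ≠ 0 := by
    by_contra hcon
    simp only [not_or, not_not] at hcon
    apply hv
    ext i
    fin_cases i
    · simpa using hcon.1
    · simpa using hcon.2
  rcases hne with h | h
  · have h1 : 0 < v 0 * v 0 := mul_self_pos.2 h
    have h2 : 0 ≤ v 1 * v 1 := mul_self_nonneg _
    nlinarith [mul_neg_of_neg_of_pos hK₀ h1, mul_nonpos_of_nonpos_of_nonneg hK₁.le h2]
  · have h1 : 0 < v 1 * v 1 := mul_self_pos.2 h
    have h2 : 0 ≤ v 0 * v 0 := mul_self_nonneg _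
    nlinarith [mul_neg_of_neg_of_pos hK₁ h1, mul_nonpos_of_nonpos_of_nonneg hK₀.le h2]

/-! ### The chart-zone function on `ℝ³` and its radial thickening on `ℝ⁴` -/

section Thickening

open RadialThickening PlanarThickening

variable {U R : ℝ → ℝ} {η β₀ κ : ℝ}

/-- **The chart-zone function** `Φ(x, b) = U(η - |x|² + b) · ((β₀ + |x|²)(β₀ - b)/β₀) ·
w(c(ĝ(x) + (κ/η)|x|² b)) · R(|x|²)` on `ℝ³` (`x ∈ ℝ²`, `b` the squared co-core radius): the
product of the two face functions `u = s`, `v = T - s` (height form of the face `{b = β₀}`),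
the weight and the radial correction; its radial thickening `Φ(x, |y|²)` is the second sector's
`Ψ₂` on the chart zone. [cite: GayKirby2016, §4, Lemma 14] -/
def zoneFn (U w ρ R : ℝ → ℝ) (c ε η β₀ κ : ℝ) (q : 𝔼 3) : ℝ :=
  U (η - nsq (PlanarThickening.proj q) + q 2) *
    ((β₀ + nsq (PlanarThickening.proj q)) * (β₀ - q 2) / β₀) *
    w (c * (gmod ε ρ (PlanarThickening.proj q) + κ / η * nsq (PlanarThickening.proj q) * q 2)) *
    R (nsq (PlanarThickening.proj q))

/-- Unfolding of `zoneFn`. [folklore] -/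
theorem zoneFn_apply (U w ρ R : ℝ → ℝ) (c ε η β₀ κ : ℝ) (q : 𝔼 3) :
    zoneFn U w ρ R c ε η β₀ κ q =
      U (η - nsq (PlanarThickening.proj q) + q 2) *
        ((β₀ + nsq (PlanarThickening.proj q)) * (β₀ - q 2) / β₀) *
        w (c * (gmod ε ρ (PlanarThickening.proj q) + κ / η * nsq (PlanarThickening.proj q) * q 2)) *
        R (nsq (PlanarThickening.proj q)) := rfl

/-- **On the core plane the chart-zone function is the chart-zone core** with
`A(a) = U(η - a)(β₀ + a)R(a)`. [folklore] -/
theorem zoneFn_comp_lift (hβ₀ : β₀ ≠ 0) :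
    zoneFn U w ρ R c ε η β₀ κ ∘ (lift : 𝔼 2 →L[ℝ] 𝔼 3) =
      core (fun a => U (η - a) * (β₀ + a) * R a) w ρ c ε := by
  funext x
  simp only [comp_apply, zoneFn_apply, core_apply, proj_lift, lift_apply_two, add_zero, sub_zero, mul_zero]
  field_simp

/-- The chart-zone function is `C²` for `C²` data (`β₀ ≠ 0` not even needed: division by a
constant). [folklore] -/
theorem contDiff_zoneFn (hU : ContDiff ℝ 2 U) (hw : ContDiff ℝ 2 w) (hρ : ContDiff ℝ 2 ρ)
    (hR : ContDiff ℝ 2 R) : ContDiff ℝ 2 (zoneFn U w ρ R c ε η β₀ κ) := by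
  have hp : ContDiff ℝ 2 (PlanarThickening.proj : 𝔼 3 → 𝔼 2) := PlanarThickening.proj.contDiff
  have hn : ContDiff ℝ 2 fun q : 𝔼 3 => nsq (PlanarThickening.proj q) := contDiff_nsq.comp hp
  have h2 : ContDiff ℝ 2 fun q : 𝔼 3 => q 2 := (PlanarThickening.zc : 𝔼 3 →L[ℝ] ℝ).contDiff
  have h0 : ContDiff ℝ 2 fun q : 𝔼 3 => (PlanarThickening.proj q) 0 :=
    (d0 : 𝔼 2 →L[ℝ] ℝ).contDiff.comp hp
  have hg : ContDiff ℝ 2 fun q : 𝔼 3 => gmod ε ρ (PlanarThickening.proj q) := by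
    unfold gmod
    exact contDiff_const.sub (contDiff_const.mul ((h0.pow 2).mul (hρ.comp hn)))
  unfold zoneFn
  refine (((hU.comp ((contDiff_const.sub hn).add h2)).mul ?_).mul
    (hw.comp (contDiff_const.mul (hg.add ((contDiff_const.mul hn).mul h2))))).mul (hR.comp hn)
  exact ((contDiff_const.add hn).mul (contDiff_const.sub h2)).div_const _

/-- **`∂Φ/∂b` in the chart zone** (the derivative along `e₂` at `q = (x, b)`), `a = |x|²`,
`s = η - a + b`, `t = c(ĝ(x) + (κ/η) a b)`:
`∂Φ/∂b = R(a) ((β₀ + a)/β₀) [U'(s)(β₀ - b) w(t) - U(s) w(t) + U(s)(β₀ - b) w'(t) c (κ/η) a]`.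
[cite: GayKirby2016, §4, Lemma 14] -/
theorem fderiv_zoneFn_ez (hU : ContDiff ℝ 2 U) (hw : ContDiff ℝ 2 w) (hρ : ContDiff ℝ 2 ρ)
    (hR : ContDiff ℝ 2 R) (q : 𝔼 3) :
    fderiv ℝ (zoneFn U w ρ R c ε η β₀ κ) q ez =
      R (nsq (PlanarThickening.proj q)) * ((β₀ + nsq (PlanarThickening.proj q)) / β₀) *
        (deriv U (η - nsq (PlanarThickening.proj q) + q 2) * (β₀ - q 2) *
            w (c * (gmod ε ρ (PlanarThickening.proj q) + κ / η * nsq (PlanarThickening.proj q) * q 2)) -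
          U (η - nsq (PlanarThickening.proj q) + q 2) *
            w (c * (gmod ε ρ (PlanarThickening.proj q) + κ / η * nsq (PlanarThickening.proj q) * q 2)) +
          U (η - nsq (PlanarThickening.proj q) + q 2) * (β₀ - q 2) *
            deriv w (c * (gmod ε ρ (PlanarThickening.proj q) + κ / η * nsq (PlanarThickening.proj q) * q 2)) *
            c * (κ / η) * nsq (PlanarThickening.proj q)) := by
  set a := nsq (PlanarThickening.proj q) with ha
  set b := q 2 with hb
  set g₀ := gmod ε ρ (PlanarThickening.proj q) with hg₀
  -- the line through `q` in the direction `e₂`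
  have hline : ∀ t : ℝ, zoneFn U w ρ R c ε η β₀ κ (q + t • ez) =
      U (η - a + b + t) * ((β₀ + a) * (β₀ - b - t) / β₀) * w (c * (g₀ + κ / η * a * (b + t))) * R a := by
    intro t
    have hproj : PlanarThickening.proj (q + t • ez) = PlanarThickening.proj q := by
      rw [map_add, map_smul, proj_ez, smul_zero, add_zero]
    have h2 : (q + t • ez) 2 = q 2 + t := by simp
    rw [zoneFn_apply, hproj, h2]
    simp only [ha, hb, hg₀]
    ring_nf
  -- derivative of the line at `0`
  have hUd : ∀ s, HasDerivAt U (deriv U s) s := fun s => (hU.differentiable (by norm_num) s).hasDerivAt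
  have hwd : ∀ s, HasDerivAt w (deriv w s) s := fun s => (hw.differentiable (by norm_num) s).hasDerivAt
  have h1 : HasDerivAt (fun t : ℝ => U (η - a + b + t)) (deriv U (η - a + b)) 0 := by
    have := HasDerivAt.comp_const_add (η - a + b) 0 (hUd (η - a + b + 0))
    simpa only [add_zero] using this
  have h2 : HasDerivAt (fun t : ℝ => (β₀ + a) * (β₀ - b - t) / β₀) (-((β₀ + a) / β₀)) 0 := by
    have := (((hasDerivAt_id (0 : ℝ)).const_sub (β₀ - b)).const_mul (β₀ + a)).div_const β₀
    refine this.congr_deriv ?_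
    simp; ring
  have hin : HasDerivAt (fun t : ℝ => c * (g₀ + κ / η * a * (b + t))) (c * (κ / η * a)) 0 := by
    have := (((hasDerivAt_id (0 : ℝ)).const_add b).const_mul (κ / η * a)).const_add g₀ |>.const_mul c
    refine this.congr_deriv ?_
    simp
  have h3 : HasDerivAt (fun t : ℝ => w (c * (g₀ + κ / η * a * (b + t))))
      (deriv w (c * (g₀ + κ / η * a * b)) * (c * (κ / η * a))) 0 := by
    have := (hwd (c * (g₀ + κ / η * a * (b + 0)))).comp (0 : ℝ) hin
    simp only [add_zero] at this
    exact this
  have hprod' := ((h1.mul h2).mul h3).mul_const (R a)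
  have hprod : HasDerivAt
      (fun t : ℝ => U (η - a + b + t) * ((β₀ + a) * (β₀ - b - t) / β₀) * w (c * (g₀ + κ / η * a * (b + t))) * R a)
      _ 0 :=
    hprod'.congr_of_eventuallyEq (Eventually.of_forall fun t => by simp only [Pi.mul_apply])
  -- the line derivative is `DΦ(q) e₂`
  have hΦd : DifferentiableAt ℝ (zoneFn U w ρ R c ε η β₀ κ) q :=
    (contDiff_zoneFn (c := c) (ε := ε) (η := η) (β₀ := β₀) (κ := κ) hU hw hρ hR).differentiable (by norm_num) q
  have hcomp : HasDerivAt (fun t : ℝ => zoneFn U w ρ R c ε η β₀ κ (q + t • ez))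
      (fderiv ℝ (zoneFn U w ρ R c ε η β₀ κ) q ez) 0 := by
    have hl : HasDerivAt (fun t : ℝ => q + t • ez) ez 0 := by
      simpa using ((hasDerivAt_id (0 : ℝ)).smul_const ez).const_add q
    have hq0 : q + (0 : ℝ) • ez = q := by simp
    have hF := hΦd.hasFDerivAt
    rw [← hq0] at hF
    have := hF.comp_hasDerivAt (0 : ℝ) hl
    simpa only [zero_smul, add_zero, Function.comp_def] using this
  have hfun : (fun t : ℝ => zoneFn U w ρ R c ε η β₀ κ (q + t • ez)) =
      fun t => U (η - a + b + t) * ((β₀ + a) * (β₀ - b - t) / β₀) * w (c * (g₀ + κ / η * a * (b + t))) * R a :=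
    funext hline
  rw [hfun] at hcomp
  have heq := hcomp.unique hprod
  rw [heq]
  simp only [Pi.mul_apply, add_zero, sub_zero]
  ring

/-- **`∂Φ/∂b < 0` in the chart zone** under the design conditions: `R(a) > 0`, `β₀ > 0`, `a ≥ 0`,
`b < β₀`, `w(t) > 0`, `w'(t) ≤ 0`, `U(s) > 0`, `c κ/η ≥ 0` and the growth bound
`U'(s)(β₀ - b) < U(s)` (i.e. `(log U)'(s) < 1/(β₀ - b)`). [cite: GayKirby2016, §4, Lemma 14] -/
theorem fderiv_zoneFn_ez_neg (hU : ContDiff ℝ 2 U) (hw : ContDiff ℝ 2 w) (hρ : ContDiff ℝ 2 ρ)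
    (hR : ContDiff ℝ 2 R) {q : 𝔼 3} (hRpos : 0 < R (nsq (PlanarThickening.proj q))) (hβ₀ : 0 < β₀)
    (hb : q 2 < β₀)
    (hwpos : 0 < w (c * (gmod ε ρ (PlanarThickening.proj q) + κ / η * nsq (PlanarThickening.proj q) * q 2)))
    (hw' : deriv w (c * (gmod ε ρ (PlanarThickening.proj q) + κ / η * nsq (PlanarThickening.proj q) * q 2)) ≤ 0)
    (hUpos : 0 < U (η - nsq (PlanarThickening.proj q) + q 2)) (hcκ : 0 ≤ c * (κ / η))
    (hgrowth : deriv U (η - nsq (PlanarThickening.proj q) + q 2) * (β₀ - q 2) <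
      U (η - nsq (PlanarThickening.proj q) + q 2)) :
    fderiv ℝ (zoneFn U w ρ R c ε η β₀ κ) q ez < 0 := by
  rw [fderiv_zoneFn_ez hU hw hρ hR q]
  set a := nsq (PlanarThickening.proj q)
  set s := η - a + q 2
  set t := c * (gmod ε ρ (PlanarThickening.proj q) + κ / η * a * q 2)
  have ha : 0 ≤ a := by
    show 0 ≤ nsq (PlanarThickening.proj q)
    rw [nsq_apply]; positivity
  have hfac : 0 < R a * ((β₀ + a) / β₀) := mul_pos hRpos (div_pos (by linarith) hβ₀)
  have hbr1 : (deriv U s * (β₀ - q 2) - U s) * w t < 0 := mul_neg_of_neg_of_pos (by linarith) hwpos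
  have hbr2 : U s * (β₀ - q 2) * deriv w t * c * (κ / η) * a ≤ 0 := by
    have h1 : 0 ≤ U s * (β₀ - q 2) := mul_nonneg hUpos.le (by linarith)
    have h2 : U s * (β₀ - q 2) * deriv w t ≤ 0 := mul_nonpos_of_nonneg_of_nonpos h1 hw'
    have h3 : U s * (β₀ - q 2) * deriv w t * (c * (κ / η)) ≤ 0 := mul_nonpos_of_nonpos_of_nonneg h2 hcκ
    have h4 : U s * (β₀ - q 2) * deriv w t * (c * (κ / η)) * a ≤ 0 := mul_nonpos_of_nonpos_of_nonneg h3 ha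
    linarith [show U s * (β₀ - q 2) * deriv w t * c * (κ / η) * a =
      U s * (β₀ - q 2) * deriv w t * (c * (κ / η)) * a by ring]
  have hbr : deriv U s * (β₀ - q 2) * w t - U s * w t + U s * (β₀ - q 2) * deriv w t * c * (κ / η) * a < 0 := by
    nlinarith
  exact mul_neg_of_pos_of_neg hfac hbr

/-- **The only critical point of the thickened chart-zone function in the zone is the centre**:
if `p ∈ ℝ⁴` is a critical point of `Φ(x, |y|²)` with `∂Φ/∂b ≠ 0` at `(x, |y|²)` and the planar
hypotheses of `eq_zero_of_fderiv_core_eq_zero` hold at `x` for `A(a) = U(η - a)(β₀ + a)R(a)`,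
then `p = 0` (critical points lie on the core plane, `TrisectionsRadialThickening`, and there the
core has only the central one). [cite: GayKirby2016, §4, Lemma 14] -/
theorem eq_zero_of_isMCriticalPt_rthicken_zoneFn (hU : ContDiff ℝ 2 U) (hw : ContDiff ℝ 2 w)
    (hρ : ContDiff ℝ 2 ρ) (hR : ContDiff ℝ 2 R) (hβ₀ : β₀ ≠ 0) {p : 𝔼 4}
    (hb : fderiv ℝ (zoneFn U w ρ R c ε η β₀ κ) (toModel p) ez ≠ 0)
    (hApos : 0 < U (η - nsq (RadialThickening.proj p)) * (β₀ + nsq (RadialThickening.proj p)) *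
      R (nsq (RadialThickening.proj p)))
    (hρ0 : 0 ≤ ρ (nsq (RadialThickening.proj p))) (hρ' : deriv ρ (nsq (RadialThickening.proj p)) ≤ 0)
    (hw' : deriv w (c * gmod ε ρ (RadialThickening.proj p)) ≤ 0) (hcε : 0 ≤ c * ε)
    (hD : DesignIneq (fun a => U (η - a) * (β₀ + a) * R a) w ρ c ε (nsq (RadialThickening.proj p))
      (c * gmod ε ρ (RadialThickening.proj p)))
    (hcrit : IsMCriticalPt (𝓡 4) (rthicken (zoneFn U w ρ R c ε η β₀ κ)) p) : p = 0 := by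
  have hΦd : DifferentiableAt ℝ (zoneFn U w ρ R c ε η β₀ κ) (toModel p) :=
    (contDiff_zoneFn (c := c) (ε := ε) (η := η) (β₀ := β₀) (κ := κ) hU hw hρ hR).differentiable (by norm_num) _
  obtain ⟨h2, h3, hcore⟩ := (isMCriticalPt_rthicken_iff hΦd hb).1 hcrit
  rw [zoneFn_comp_lift hβ₀, MorseBirth.isMCriticalPt_iff_fderiv] at hcore
  have hAd : DifferentiableAt ℝ (fun a => U (η - a) * (β₀ + a) * R a) (nsq (RadialThickening.proj p)) := by
    have hUd := hU.differentiable (by norm_num)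
    have hRd := hR.differentiable (by norm_num)
    exact (((hUd _).comp _ ((differentiableAt_const _).sub differentiableAt_id)).mul
      ((differentiableAt_const _).add differentiableAt_id)).mul (hRd _)
  have hx : RadialThickening.proj p = 0 :=
    eq_zero_of_fderiv_core_eq_zero hAd ((hw.differentiable (by norm_num)) _)
      ((hρ.differentiable (by norm_num)) _) hApos hρ0 hρ' hw' hcε hD hcore
  ext i
  fin_cases i
  · simpa using congrArg (fun v : 𝔼 2 => v 0) hx
  · simpa using congrArg (fun v : 𝔼 2 => v 1) hx
  · simpa using h2
  · simpa using h3

/-! ### The centre: a nondegenerate minimum of the sector function -/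

/-- `toModel 0 = 0`. [folklore] -/
@[simp] theorem toModel_zero : toModel (0 : 𝔼 4) = 0 := by
  rw [toModel_eq_lift_proj (by simp) (by simp), map_zero, map_zero]

/-- `D(core)(0) = 0`: the centre is a critical point of the core. [folklore] -/
theorem fderiv_core_zero (hA : Differentiable ℝ A) (hw : Differentiable ℝ w) (hρ : Differentiable ℝ ρ) :
    fderiv ℝ (core A w ρ c ε) 0 = 0 := by
  rw [fderiv_core_eq hA hw hρ 0]
  simp

/-- **The sector function `1 - C Φ(x, |y|²)` has a nondegenerate critical point of index `0` at
the centre** (`C > 0`, `∂Φ/∂b(0) < 0`, design inequality at the centre): by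
`TrisectionsRadialThickening` its Hessian there is the core Hessian `-C D²Φ₀(0)` (positive
definite) plus a positive multiple of `|v_y|²`. [cite: GayKirby2016, §4, Lemma 14] [cite: Milnor1963, §2] -/
theorem morseData_rthicken_one_sub_zoneFn_zero (hU : ContDiff ℝ 2 U) (hw : ContDiff ℝ 2 w)
    (hρ : ContDiff ℝ 2 ρ) (hR : ContDiff ℝ 2 R) (hβ₀ : β₀ ≠ 0) {C : ℝ} (hC : 0 < C)
    (hb : fderiv ℝ (zoneFn U w ρ R c ε η β₀ κ) 0 ez < 0)
    (hApos : 0 < U η * β₀ * R 0) (hρ0 : 0 ≤ ρ 0) (hw' : deriv w c ≤ 0) (hcε : 0 ≤ c * ε)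
    (hD : DesignIneq (fun a => U (η - a) * (β₀ + a) * R a) w ρ c ε 0 c) :
    IsMCriticalPt (𝓡 4) (rthicken fun q => 1 - C * zoneFn U w ρ R c ε η β₀ κ q) 0 ∧
      (mhessian (𝓡 4) (rthicken fun q => 1 - C * zoneFn U w ρ R c ε η β₀ κ q) 0).Nondegenerate ∧
      morseIndex (𝓡 4) (rthicken fun q => 1 - C * zoneFn U w ρ R c ε η β₀ κ q) 0 = 0 := by
  set Φ := zoneFn U w ρ R c ε η β₀ κ with hΦdef
  set A : ℝ → ℝ := fun a => U (η - a) * (β₀ + a) * R a with hAdef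
  have hΦc : ContDiff ℝ 2 Φ := contDiff_zoneFn hU hw hρ hR
  have hΦ'c : ContDiff ℝ 2 fun q => 1 - C * Φ q := contDiff_const.sub (contDiff_const.mul hΦc)
  have hΦ'2 : ContDiffAt ℝ 2 (fun q => 1 - C * Φ q) (toModel 0) := hΦ'c.contDiffAt
  have hΦ'd : DifferentiableAt ℝ (fun q => 1 - C * Φ q) (toModel 0) := hΦ'2.differentiableAt (by norm_num)
  -- `∂/∂b` of `1 - CΦ` at `0` is positive
  have hfd : fderiv ℝ (fun q => 1 - C * Φ q) = fun q => -C • fderiv ℝ Φ q := by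
    funext q
    have hd : DifferentiableAt ℝ Φ q := hΦc.differentiable (by norm_num) q
    rw [fderiv_const_sub, fderiv_const_mul hd, neg_smul]
  have hb' : 0 < fderiv ℝ (fun q => 1 - C * Φ q) (toModel 0) ez := by
    rw [hfd, toModel_zero]
    simp only [FunLike.coe_smul, Pi.smul_apply, smul_eq_mul]
    nlinarith
  -- the core of `1 - CΦ`
  have hA2 : ContDiff ℝ 2 A :=
    ((hU.comp (contDiff_const.sub contDiff_id)).mul (contDiff_const.add contDiff_id)).mul hR
  have hcoreΦ : Φ ∘ (lift : 𝔼 2 →L[ℝ] 𝔼 3) = core A w ρ c ε := zoneFn_comp_lift hβ₀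
  have hcore' : (fun q => 1 - C * Φ q) ∘ (lift : 𝔼 2 →L[ℝ] 𝔼 3) = fun x => 1 - C * core A w ρ c ε x := by
    funext x
    have := congrFun hcoreΦ x
    simp only [comp_apply] at this ⊢
    rw [this]
  have hAd := hA2.differentiable (by norm_num)
  have hwd := hw.differentiable (by norm_num)
  have hρd := hρ.differentiable (by norm_num)
  have hcored : Differentiable ℝ (core A w ρ c ε) := fun x => differentiableAt_core (hAd _) (hwd _) (hρd _)
  have hfd2 : fderiv ℝ (fun x => 1 - C * core A w ρ c ε x) = fun x => -C • fderiv ℝ (core A w ρ c ε) x := by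
    funext x
    rw [fderiv_const_sub, fderiv_const_mul (hcored x), neg_smul]
  -- criticality at the centre
  have hcrit2 : IsMCriticalPt (𝓡 2) ((fun q => 1 - C * Φ q) ∘ (lift : 𝔼 2 →L[ℝ] 𝔼 3)) (RadialThickening.proj 0) := by
    rw [hcore', map_zero, MorseBirth.isMCriticalPt_iff_fderiv, hfd2]
    simp only [fderiv_core_zero hAd hwd hρd, smul_zero]
  have hcrit : IsMCriticalPt (𝓡 4) (rthicken fun q => 1 - C * Φ q) 0 :=
    (isMCriticalPt_rthicken_iff hΦ'd hb'.ne').2 ⟨rfl, rfl, hcrit2⟩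
  -- the planar Hessian of `1 - C core` at `0` is positive definite
  have hH2 : ∀ v u : 𝔼 2, fderiv ℝ (fderiv ℝ (fun x => 1 - C * core A w ρ c ε x)) 0 v u =
      -C * fderiv ℝ (fderiv ℝ (core A w ρ c ε)) 0 v u := by
    intro v u
    have hD := hasFDerivAt_fderiv_core_zero (c := c) (ε := ε) hA2 hw hρ
    have hD' : HasFDerivAt (fun x => -C • fderiv ℝ (core A w ρ c ε) x) (-C • _) 0 := hD.const_smul (-C)
    rw [hfd2, hD'.fderiv, hD.fderiv]
    simp only [smul_apply, smul_eq_mul]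
  have hApos0 : 0 < A 0 := by simp only [hAdef, sub_zero, add_zero]; exact hApos
  have hpd : ∀ v : 𝔼 2, v ≠ 0 → 0 < fderiv ℝ (fderiv ℝ (fun x => 1 - C * core A w ρ c ε x)) 0 v v := by
    intro v hv
    rw [hH2]
    have := fderiv_fderiv_core_zero_apply_self_neg hA2 hw hρ hApos0 hρ0 hw' hcε hD hv
    nlinarith
  have hposdef : (mhessian (𝓡 2) ((fun q => 1 - C * Φ q) ∘ (lift : 𝔼 2 →L[ℝ] 𝔼 3))
      (RadialThickening.proj 0)).toQuadraticMap.PosDef := by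
    intro v hv
    rw [hcore', map_zero]
    simp only [LinearMap.BilinMap.toQuadraticMap_apply, MorseBirth.mhessian_model_apply]
    exact hpd v hv
  have hnd2 : (mhessian (𝓡 2) ((fun q => 1 - C * Φ q) ∘ (lift : 𝔼 2 →L[ℝ] 𝔼 3))
      (RadialThickening.proj 0)).Nondegenerate := by
    refine ⟨fun v hv => ?_, fun v hv => ?_⟩
    · by_contra h0
      have := hposdef v h0
      simp only [LinearMap.BilinMap.toQuadraticMap_apply, hv v] at this
      exact lt_irrefl _ this
    · by_contra h0
      have := hposdef v h0
      simp only [LinearMap.BilinMap.toQuadraticMap_apply, hv v] at this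
      exact lt_irrefl _ this
  refine ⟨hcrit, ?_, ?_⟩
  · exact (nondegenerate_mhessian_rthicken_iff hΦ'2 rfl rfl hb'.ne').2 hnd2
  · rw [morseIndex_rthicken hΦ'2 rfl rfl hb']
    unfold morseIndex
    exact LinearMap.BilinForm.sigNeg_eq_zero_of_posDef hposdef

end Thickening

end ChartZone

end Literature.Topology.FourManifolds

end
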